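import Summits.QuantumFields.YangMills.Theses.BalabanLadder
import Summits.QuantumFields.YangMills.Theorems.LangevinControlUVOSLegsFromFemtoAndGapStubPinOfContinuous
import Summits.QuantumFields.YangMills.Theorems.LangevinControlUVOSLegsFromFemtoAndGapStubLower
import Summits.QuantumFields.YangMills.Theorems.LangevinControlUVOSLegsAtWeakCouplingCFblOfFbl6
import HarnessLib

/-!
# Crux `NT` (stmt-QuantumFields-19353, route `BalabanLadder`, rung R2a): the two registered stubs against the tree

Helper file (`--supports stmt-QuantumFields-19353`) of the fleet lead prover of crux `NT` (unit `ym-spine-19353-p1`).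
The skeleton of record `Cruxes/NT/Lines/birth.lean` (sha16 `ebeee5246da63a4f`) has two stubs,
`stub_ntfemto : NTFemto` (`∀ G` compact simple, `∃ (r, a)`, `TwoPointPinned G r a ∧ Skewness G r a`) and
`stub_fcp6 : Statement.stub_fcp6` (the engine item of crux 9367's line `dlr-collar-transfer`, BY NAME), composed by
`NT_of` through the landed `stub_lower` and `fbl_of_fbl6`.  This file kernel-checks the DEDUP MAP of both stubs against
items that already exist under route `LangevinControlUV`, and the minimal hypothesis the composition really consumes:

* `exists_continuous_pinned_skewness` — for every compact simple `G` and EVERY lattice representation `r`: the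
  tier-deciding cruxes `FemtoCurvatureTwoPointC` (stmt-QuantumFields-16204) and `FemtoCurvatureSkewnessC`
  (stmt-QuantumFields-16205) give a CONTINUOUS unit map `a` carrying `TwoPointPinned G r a ∧ Skewness G r a` (the
  pinning clause is the landed `twoPointPinned_of_continuous`, no `GapInUnits` needed);
* `ntFemto_of_femtoC` — hence the body of `NTFemto` VERBATIM (`stub_ntfemto` closes by
  `exact ntFemto_of_femtoC h₁ h₂` once 16204 and 16205 are proved: stub 1 of `NT` has no content of its own);
* `nt_of_conditionalPackage` — the composition `NT_of` consumes of the femto TORUS packages only the two units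
  clauses `0 < a`, `a → 0`: the crux `BalabanLadder.NT` follows BY NAME from the existence, for ONE `(r, a)`, of the
  frozen-boundary femto package `FBL ∧ FC2 ∧ FC3` alone (landed `stub_lower`) — a strictly weaker engine input than
  `stub_ntfemto ⊕ stub_fcp6` (no torus two-point/skewness package, no plane resolution, one representation);
* `nt_of_femtoC_of_fcp6` — `BalabanLadder.NT` BY NAME from 16204 ∧ 16205 ∧ `Statement.stub_fcp6`, i.e. crux NT is in
  the cone of route `LangevinControlUV`'s registered items; `legs_of_femtoC_of_fcp6` records the strongest per-`r`
  output (for EVERY `r` a continuous unit with the torus packages AND `LowerBounds`), the shape the seam crux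
  `UVSeamRec` (stmt-QuantumFields-20043, `FloorsCEngine.lowerBounds_uRec_of_femtoEngine`) consumes at `G = SU(2)`.

All theorems taking `FemtoCurvatureTwoPointC` / `FemtoCurvatureSkewnessC` / `Statement.stub_fcp6` as hypotheses are
CONDITIONAL bridges (named route items, unproved); `nt_of_conditionalPackage` is unconditional.
-/

set_option autoImplicit false

noncomputable section

open MeasureTheory Filter Topology
open Literature.MathematicalPhysics.QuantumFieldTheory Literature.MathematicalPhysics.QuantumLattice
open Summit.QuantumFields.YangMills.Theses.LangevinControlUV (FemtoCurvatureTwoPointC FemtoCurvatureSkewnessC)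
open Summit.QuantumFields.YangMills.Cruxes.OSLegsFromFemtoAndGap.DlrCollarTransfer

namespace Summit.QuantumFields.YangMills.Cruxes.NT.Bridges

/-- **The femto torus packages at a continuous unit, for every representation, from the two tier-deciding cruxes of
route `LangevinControlUV`.**  For a compact simple `G` (Borel σ-algebra) and ANY lattice representation `r`:
`FemtoCurvatureTwoPointC` gives a continuous unit map with the two-point package H1, `FemtoCurvatureSkewnessC` upgrades
it to a continuous unit map `a` carrying H1 and the skewness witness H2 together, and the landed interval pinning
`twoPointPinned_of_continuous` (IVT + compactness + continuity of `β ↦ wilsonExpectation`) turns H1 into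
`TwoPointPinned G r a`. [conditional bridge] -/
theorem exists_continuous_pinned_skewness (h₁ : FemtoCurvatureTwoPointC) (h₂ : FemtoCurvatureSkewnessC)
    (G : Type) [Group G] [TopologicalSpace G] [IsTopologicalGroup G] [CompactSpace G]
    (hG : IsCompactSimpleLieGroup G) :
    letI : MeasurableSpace G := borel G
    haveI : BorelSpace G := ⟨rfl⟩
    ∀ r : LatticeRep G, ∃ a : ℝ → ℝ, Continuous a ∧ TwoPointPinned G r a ∧ Skewness G r a := by
  letI : MeasurableSpace G := borel G
  haveI : BorelSpace G := ⟨rfl⟩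
  intro r
  obtain ⟨a, ha, hTP, hSk⟩ := h₂ G hG r (h₁ G hG r)
  exact ⟨a, ha, twoPointPinned_of_continuous G r a ha hTP, hSk⟩

/-- **`stub_ntfemto` is the content of stmt-QuantumFields-16204 ∧ 16205.**  The body of the skeleton's
`NTFemto` — for every compact simple `G`, `∃ (r : LatticeRep G) (a : ℝ → ℝ), TwoPointPinned G r a ∧ Skewness G r a` —
VERBATIM, from `FemtoCurvatureTwoPointC` and `FemtoCurvatureSkewnessC` (a lattice representation exists because
`IsCompactSimpleLieGroup G` carries `Nonempty (LatticeRep G)`). [conditional bridge] -/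
theorem ntFemto_of_femtoC (h₁ : FemtoCurvatureTwoPointC) (h₂ : FemtoCurvatureSkewnessC) :
    ∀ (G : Type) [Group G] [TopologicalSpace G] [IsTopologicalGroup G] [CompactSpace G],
      IsCompactSimpleLieGroup G → letI : MeasurableSpace G := borel G; haveI : BorelSpace G := ⟨rfl⟩;
      ∃ (r : LatticeRep G) (a : ℝ → ℝ), TwoPointPinned G r a ∧ Skewness G r a := by
  intro G _ _ _ _ hG
  obtain ⟨r⟩ := hG.2
  obtain ⟨a, -, hpin, hsk⟩ := exists_continuous_pinned_skewness h₁ h₂ G hG r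
  exact ⟨r, a, hpin, hsk⟩

/-- **What the composition `NT_of` really consumes: the frozen-boundary femto package for ONE `(r, a)`.**  If for
every compact simple `G` some lattice representation `r` and some unit map `a` (`0 < a`, `a → 0`) carry the
conditional femto package `FBL G r a ∧ FC2 G r a ∧ FC3 G r a` (boundary law, two-sided conditional two-point bounds,
signed conditional third cumulant — uniformly in the exterior), then `BalabanLadder.NT` holds BY NAME: the landed
collar lower bounds `stub_lower` (`FBL → FC2 → FC3 → LowerBounds`).  No torus two-point package, no skewness witness,
no plane resolution (`FBL6`) is used. [folklore] -/
theorem nt_of_conditionalPackage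
    (h : ∀ (G : Type) [Group G] [TopologicalSpace G] [IsTopologicalGroup G] [CompactSpace G],
      IsCompactSimpleLieGroup G → letI : MeasurableSpace G := borel G; haveI : BorelSpace G := ⟨rfl⟩;
      ∃ (r : LatticeRep G) (a : ℝ → ℝ), (∀ β, 0 < a β) ∧ Tendsto a atTop (𝓝 0) ∧
        FBL G r a ∧ FC2 G r a ∧ FC3 G r a) :
    Summit.QuantumFields.YangMills.Theses.BalabanLadder.NT := by
  intro G _ _ _ _ hG
  letI : MeasurableSpace G := borel G
  haveI : BorelSpace G := ⟨rfl⟩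
  obtain ⟨r, a, ha, ha0, hfbl, hfc2, hfc3⟩ := h G hG
  exact ⟨r, a, ha, ha0, stub_lower G r a ha ha0 hfbl hfc2 hfc3⟩

/-- **The strongest per-representation output of the two femto cruxes and the engine item.**  For a compact simple
`G` and EVERY lattice representation `r`: `FemtoCurvatureTwoPointC`, `FemtoCurvatureSkewnessC` and
`Statement.stub_fcp6` give one CONTINUOUS unit map `a` (`0 < a`, `a → 0`) carrying the pinned torus two-point
package, the skewness witness, the plane-resolved boundary law, the conditional package and the k-free lattice
lower bounds `LowerBounds G r a` (through the landed `fbl_of_fbl6` and `stub_lower`). [conditional bridge] -/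
theorem legs_of_femtoC_of_fcp6 (h₁ : FemtoCurvatureTwoPointC) (h₂ : FemtoCurvatureSkewnessC)
    (h₆ : Statement.stub_fcp6)
    (G : Type) [Group G] [TopologicalSpace G] [IsTopologicalGroup G] [CompactSpace G]
    (hG : IsCompactSimpleLieGroup G) :
    letI : MeasurableSpace G := borel G
    haveI : BorelSpace G := ⟨rfl⟩
    ∀ r : LatticeRep G, ∃ a : ℝ → ℝ, Continuous a ∧ (∀ β, 0 < a β) ∧ Tendsto a atTop (𝓝 0) ∧
      TwoPointPinned G r a ∧ Skewness G r a ∧ FBL6 G r a ∧ FBL G r a ∧ FC2 G r a ∧ FC3 G r a ∧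
      LowerBounds G r a := by
  letI : MeasurableSpace G := borel G
  haveI : BorelSpace G := ⟨rfl⟩
  intro r
  obtain ⟨a, hcont, hpin, hsk⟩ := exists_continuous_pinned_skewness h₁ h₂ G hG r
  obtain ⟨hfbl6, hfc2, hfc3⟩ := h₆ G hG r a hpin hsk
  have hunits := hpin
  obtain ⟨Γ, β₀, ℓ₀, c, C, -, -, ha, ha0, -⟩ := hunits
  have hfbl : FBL G r a := fbl_of_fbl6 r a hfbl6
  exact ⟨a, hcont, ha, ha0, hpin, hsk, hfbl6, hfbl, hfc2, hfc3, stub_lower G r a ha ha0 hfbl hfc2 hfc3⟩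

/-- **Crux `NT` is in the cone of route `LangevinControlUV`'s items**: `FemtoCurvatureTwoPointC`
(stmt-QuantumFields-16204) ∧ `FemtoCurvatureSkewnessC` (stmt-QuantumFields-16205) ∧ `Statement.stub_fcp6` (engine item
of crux stmt-QuantumFields-9367, line `dlr-collar-transfer`) ⇒ `BalabanLadder.NT` BY NAME — for every compact simple
`G`, with ANY lattice representation as the witness `r` and the femto cruxes' continuous unit map as `a`.
[conditional bridge] -/
theorem nt_of_femtoC_of_fcp6 (h₁ : FemtoCurvatureTwoPointC) (h₂ : FemtoCurvatureSkewnessC)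
    (h₆ : Statement.stub_fcp6) : Summit.QuantumFields.YangMills.Theses.BalabanLadder.NT := by
  refine nt_of_conditionalPackage fun G _ _ _ _ hG => ?_
  letI : MeasurableSpace G := borel G
  haveI : BorelSpace G := ⟨rfl⟩
  obtain ⟨r⟩ := hG.2
  obtain ⟨a, -, ha, ha0, -, -, -, hfbl, hfc2, hfc3, -⟩ := legs_of_femtoC_of_fcp6 h₁ h₂ h₆ G hG r
  exact ⟨r, a, ha, ha0, hfbl, hfc2, hfc3⟩

end Summit.QuantumFields.YangMills.Cruxes.NT.Bridges

end
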